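import Literature.Probability.LatticeModels.HardCoreUrsell
import Mathlib.Analysis.SpecialFunctions.Log.Basic

/-!
# `BalabanImbrieJaffe1984to88.BIJ88Resummation5141` — T. Bałaban, J. Imbrie, A. Jaffe, *Effective action and cluster properties of
the abelian Higgs model*, Commun. Math. Phys. **114** (1988) 257–315 [BalabanImbrieJaffe1988]: Sect. 5.14, p. 308 — the display
**(5.14.1)** `Σ_{{X_α}} Π_α g₂(X_α) = Σ_{{X_α} overlapping Λ₁₁^{(k)c}} Π_α g₂(X_α) z_F(Λ₁₂^{(k)})` (*"we resum the decoupling and Mayer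
expansions in Λ₁₂^{(k)}"*) DERIVED over the cube-index polymer model: the resummation bijection on fillings, (5.14.1) from the cluster
expansion (5.13.4) in the large-field-free subregions, and `z_F(Λ₁₂) = Σ_{fillings} Π g₂` from a linear expectation, the Mayer product
expansion and the fixed-Mayer-set decoupling expansion of Sect. 5.13 (displayed hypothesis), with `g₂ = Σ_{S compatible} g₁` (p. 306).

HONEST FRAMING (cell `lit-balaban`, verbatim): statement-level skeleton of published theorems with citation tags; proofs where landed; nothing here is a claim about the Yang–Mills mass gap.

PDF held: `paper:balaban1988-cmp114-bij-abelian-higgs-effective-action` (journal page = PDF page + 256); p. 306 = PDF p. 50 and p. 308 =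
PDF p. 52 (renders `original-p050-x2.png`, `original-p052-x2.png`; materialised text `p0050.txt`, `p0052.txt`).

CITATION HEADER (verbatim).  p. 306 [PDF 50]: *"Thus our expression for d/ds_Γ⟨Π_{i∈I} f(□_i)⟩_{s_Γ} factorizes over the connected
components of Γ. … The expression also factorizes over the □_i, i ∈ I∖Γ. Call the factorization regions clusters. It is worth mentioning
here that only clusters intersecting Λ₁₁^{(k)c} have any dependence on Λ₁₀^{(k)c}φ^{(k)}, Λ₁₀^{(k)c*}A^{(k)}. … We denote by Λ₁₂^{(k)} the
set of sites in clusters not intersecting Λ₁₁^{(k)c}. … Here s = {s_i : □_i ⊂ X}, and ⟨·⟩_{s_Γ,X} is defined by integrating over the fields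
in X only. We obtain the following expressions for the dμ_{Λ₁₀^{(k)}}-integral in (5.12.8): Σ_{S_Y}Σ_{S₅} e^{−V^{(k)}_{const}(Λ₈^{(k)})}
Σ_{{X_α} filling Λ₁₀^{(k)}} Π_α g₁(X_α) = e^{−V^{(k)}_{const}(Λ₈^{(k)})} Σ_{{X_α}} Π_α g₂(X_α). (5.13.4) Here g₂(X_α) is obtained by summing
over S_Y, S₅ compatible with X_α (each Y, X is contained in X_α or the corresponding component of Λ₁₁^{(k)c}): g₂(X_α) = Σ_{S_Y,S₅
compatible with X_α} g₁(X_α)."*  p. 308 [PDF 52]: *"To extract the perturbative terms, we resum the decoupling and Mayer expansions in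
Λ₁₂^{(k)}. Note that W₅^{(k)}(X) ≠ 0 only for X at the boundary of Λ₁₀^{(k)}. Thus W₅^{(k)}-terms will not appear in the resummed
expansion. We obtain for the expansion in (5.13.4) Σ_{{X_α}} Π_α g₂(X_α) = Σ_{{X_α} overlapping Λ₁₁^{(k)c}} Π_α g₂(X_α) z_F(Λ₁₂^{(k)}),
where z_F(Λ₁₂^{(k)}) = ⟨χ′_{Λ₁₂^{(k)}} Π_{σ₁: X_{σ₁}⊂Λ₁₂^{(k)}} F^{m̄}_{k,loc}(X_{σ₁}) e^{−Ṽ^{(k)}(Λ₁₂^{(k)})}⟩_{1,Λ₁₂^{(k)}}, Ṽ^{(k)}(Λ₁₂^{(k)})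
= Σ_{Y⊂Λ₁₂^{(k)}} V^{(k)}(Y). (5.14.1) … We treat z_F(Λ₁₂^{(k)}) as follows: z_F(Λ₁₂^{(k)}) = (z_F(Λ₁₂^{(k)})/z(Λ₁₂^{(k)}))
exp(log z(Λ₁₂^{(k)})), where z(Λ₁₂^{(k)}) = z_{F=1}(Λ₁₂^{(k)})"*.

WHAT IS REPRODUCED (unit `lit-balaban-p25`, generation 7 of the Phase-2 proof seat p25; SKELETON row `C2.Eq5.14.1-5.14.2`, the
display (5.14.1) proper — (5.14.2) is `BIJ88Sect5StatementsPart4.pertP`/`remR`; HOME `run/shared/lean/pub/lit-balaban/lit-balaban-p25/`).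
MODEL (as in the gen-5/6 files of this seat, `BIJ88W6PrimeBound`/`BIJ88ConnectedGraphResummation`): the r(e_k)-cubes of Λ₁₀^{(k)} are a
finite index set `W : Finset ι`; `B ⊆ ι` are the cubes meeting Λ₁₁^{(k)c}; a cluster `X` is a nonempty finite set of cube indices and a
family `{X_α}` *"filling"* a region is a set partition of it (`Literature.Probability.LatticeModels.setPartitions`); the activities
`g X : R` (commutative ring) are arbitrary — connectivity of clusters is not modelled (the activity of a non-cluster may be taken `0`;
every identity below holds for every `g`).
§1 `Overlaps B X` (*"X_α overlapping Λ₁₁^{(k)c}"*), the outer families `outer W B` (pairwise disjoint clusters in `W`, each overlapping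
  Λ₁₁ᶜ, covering `W ∩ B`), `lam12 W ρ = W ∖ ⋃ρ` (*"Λ₁₂ = the set of sites in clusters not intersecting Λ₁₁^{(k)c}"*; `lam12_outerPart`:
  = the union of the non-overlapping clusters), `disjoint_lam12` (Λ₁₂ is large-field-free).
§2 THE RESUMMATION BIJECTION (`sum_setPartitions_split`, `sum_setPartitions_prod_split`): `π ↦ (clusters of π overlapping Λ₁₁ᶜ, the
  others)` is a bijection from the fillings of `W` onto the pairs (outer family `ρ`, filling of `lam12 W ρ`), inverse `(ρ, κ) ↦ ρ ∪ κ`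
  (`outerPart_mem_outer`, `innerPart_mem_setPartitions`, `union_isSetPartition`, `outerPart_union`, `innerPart_union`); hence
  `Σ_{{X_α} filling W} Π g = Σ_{{X_α} overlapping Λ₁₁ᶜ} Π g · Σ_{{Y_β} filling Λ₁₂} Π g` for every `g`.
§3 (5.14.1) ABSTRACTLY (`eq5141_of_clusterExpansion`): if the cluster expansion (5.13.4) holds with the same activities in every
  subregion `W' ⊆ W` free of large-field cubes (`hce`), the full expansion regroups as printed with `z_F(Λ₁₂)` the un-expanded quantity.
§4 *"WE RESUM THE DECOUPLING AND MAYER EXPANSIONS IN Λ₁₂"* (`zF_eq_sum_fillings`): fields `φ : Φ`, observables `Φ → R`, a LINEAR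
  expectation `E W' : (Φ → R) →ₗ[R] R` (= ⟨·⟩_{1,W'}), an observable `G W'` (= χ′_{W'} Π_{σ₁: X_{σ₁}⊂W'} F^{m̄}_{k,loc}(X_{σ₁})), Mayer
  polymers `Ys` with one-polymer Boltzmann factors `b Y` (= e^{−V^{(k)}(Y)}: `boltz_exp`, `Vtilde`), `zF E G Ys b W' = E W' (G W' ·
  Π_{Y⊂W'} b Y)` (= the printed z_F); the Mayer expansion `Π_{Y⊂W'} b_Y = Σ_{S} Π_{Y∈S}(b_Y − 1)` (`boltz_eq_sum_mayer`, the (5.11.2)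
  shape) and linearity (`zF_eq_sum_zS`); the EXCHANGE `Σ_{S compatible with κ} Π_{X∈κ} g₁(X; S∩𝒫(X)) = Π_{X∈κ} g₂(X)` with
  `g₂ X = Σ_{T ⊆ 𝒫(X)} g₁ X T` (`sum_compat_prod_eq_prod_g2`, `eq5134_exchange` — the right-hand equality of (5.13.4) inside Λ₁₂);
  the W₅-remark (`polysIn_union_of_overlaps`: polymers overlapping Λ₁₁ᶜ never lie inside a large-field-free region).
§5 (5.14.1) ASSEMBLED (`eq5141`): from `hdec` = the fixed-Mayer-set decoupling expansion of Sect. 5.13 ((5.13.3) + the p. 306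
  factorization into clusters, the activity of a cluster depending on the Mayer set only through the polymers inside it — *"integrating
  over the fields in X only"*) in every large-field-free `W' ⊆ W`, and `hg` = on the clusters not intersecting Λ₁₁ᶜ the activities of
  (5.13.4) are the Mayer sums `g₂` (p. 306 last display); plus `zF_eq_ratio_mul_exp_log` (the display *"z_F = (z_F/z) exp(log z)"*, `z > 0`).
HYPOTHESES, all explicit and displayed in the statements: `hdec` (shape above; the expansion (5.13.3) is NOT reproduced — rows
`C2.Eq5.13.3-5.13.4`), `hg`, `∀ Y ∈ Ys, Y.Nonempty`; in §3 `hce`.  READINGS (declared): (a) *"compatible with X_α"* inside Λ₁₂ = every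
Mayer polymer of `S` is contained in a cluster (`Compat`; the alternative *"or the corresponding component of Λ₁₁^{(k)c}"* concerns the
outer clusters only, whose activities stay abstract here); (b) *"{X_α} overlapping Λ₁₁^{(k)c}"* = the outer sub-family of a filling, which
covers `W ∩ B` (`outer`; p. 306 defines Λ₁₂ through the clusters, `lam12_outerPart`); (c) ⟨·⟩_{1,W'} is an `R`-linear functional on all
observables `Φ → R` (no integrability bookkeeping).  All statements are finite identities; 0 `sorry`, 0 new `Prop` facts.
-/

open Finset
open Literature.Probability.LatticeModels (IsSetPartition setPartitions mem_setPartitions)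

namespace Literature.MathematicalPhysics.QuantumFieldTheory.BalabanImbrieJaffe1984to88.BIJ88Resummation5141

variable {ι : Type*} [DecidableEq ι]

/-! ## §1 Clusters overlapping Λ₁₁ᶜ, the outer families `{X_α}` of (5.14.1), and the region Λ₁₂ -/

/-- p. 308 [PDF 52], the index set of (5.14.1) *"{X_α} overlapping Λ₁₁^{(k)c}"*: the cluster `X` (a set of r(e_k)-cube indices)
OVERLAPS Λ₁₁^{(k)c}, i.e. contains one of the cubes `B` meeting Λ₁₁^{(k)c} (p. 306: *"clusters intersecting Λ₁₁^{(k)c}"*).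
[cite: BalabanImbrieJaffe1988, (5.14.1) p.308] -/
def Overlaps (B X : Finset ι) : Prop := (X ∩ B).Nonempty

/-- decidability of `Overlaps` (a finite intersection is nonempty). [cite: BalabanImbrieJaffe1988, (5.14.1) p.308] -/
instance instDecidableOverlaps (B X : Finset ι) : Decidable (Overlaps B X) :=
  inferInstanceAs (Decidable (X ∩ B).Nonempty)

/-- `X` overlaps Λ₁₁ᶜ iff one of its cubes is a large-field cube. [cite: BalabanImbrieJaffe1988, (5.14.1) p.308] -/
theorem overlaps_iff {B X : Finset ι} : Overlaps B X ↔ ∃ i ∈ X, i ∈ B := by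
  simp only [Overlaps, Finset.Nonempty, mem_inter]

/-- *"clusters not intersecting Λ₁₁^{(k)c}"* (p. 306): not overlapping = disjoint from the large-field cubes.
[cite: BalabanImbrieJaffe1988, p.306 (Sect. 5.13)] -/
theorem not_overlaps_iff_disjoint {B X : Finset ι} : ¬ Overlaps B X ↔ Disjoint X B := by
  rw [Overlaps, not_nonempty_iff_eq_empty, disjoint_iff_inter_eq_empty]

/-- a subset of a region free of large-field cubes does not overlap Λ₁₁ᶜ. [cite: BalabanImbrieJaffe1988, p.306 (Sect. 5.13)] -/
theorem not_overlaps_of_subset {B W' X : Finset ι} (hX : X ⊆ W') (hW' : Disjoint W' B) : ¬ Overlaps B X :=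
  not_overlaps_iff_disjoint.2 (hW'.mono_left hX)

/-- p. 308 [PDF 52], the summation index of the right side of (5.14.1), *"{X_α} overlapping Λ₁₁^{(k)c}"*: the families `ρ = {X_α}`
of pairwise disjoint (nonempty) clusters `X_α ⊆ W`, each overlapping Λ₁₁ᶜ, which jointly contain every large-field cube of `W`
(these are exactly the sub-families "clusters overlapping Λ₁₁^{(k)c}" of the fillings `{X_α}` of `W = Λ₁₀^{(k)}` in (5.13.4):
`outerPart_mem_outer`, `union_isSetPartition`). [cite: BalabanImbrieJaffe1988, (5.14.1) p.308] -/
def outer (W B : Finset ι) : Finset (Finset (Finset ι)) :=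
  W.powerset.powerset.filter fun ρ => IsSetPartition (ρ.biUnion id) ρ ∧ (∀ X ∈ ρ, Overlaps B X) ∧ W ∩ B ⊆ ρ.biUnion id

/-- membership in `outer`. [cite: BalabanImbrieJaffe1988, (5.14.1) p.308] -/
theorem mem_outer {W B : Finset ι} {ρ : Finset (Finset ι)} :
    ρ ∈ outer W B ↔
      (∀ X ∈ ρ, X ⊆ W) ∧ IsSetPartition (ρ.biUnion id) ρ ∧ (∀ X ∈ ρ, Overlaps B X) ∧ W ∩ B ⊆ ρ.biUnion id := by
  simp only [outer, mem_filter, mem_powerset]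
  constructor
  · rintro ⟨h, h'⟩
    exact ⟨fun X hX => mem_powerset.1 (h hX), h'⟩
  · rintro ⟨h, h'⟩
    exact ⟨fun X hX => mem_powerset.2 (h X hX), h'⟩

/-- the union of an outer family lies in the region. [cite: BalabanImbrieJaffe1988, (5.14.1) p.308] -/
theorem biUnion_subset_of_mem_outer {W B : Finset ι} {ρ : Finset (Finset ι)} (hρ : ρ ∈ outer W B) : ρ.biUnion id ⊆ W := by
  intro i hi
  obtain ⟨X, hX, hiX⟩ := mem_biUnion.1 hi
  exact (mem_outer.1 hρ).1 X hX hiX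

/-- p. 306 [PDF 50], verbatim: *"We denote by Λ₁₂^{(k)} the set of sites in clusters not intersecting Λ₁₁^{(k)c}."* — at the level of
cubes: the complement in the region `W` (= the cubes of Λ₁₀^{(k)}) of the union of the clusters overlapping Λ₁₁ᶜ; for the outer part of
a filling this IS the union of the clusters not overlapping Λ₁₁ᶜ (`lam12_outerPart`). [cite: BalabanImbrieJaffe1988, p.306 (Sect. 5.13)] -/
def lam12 (W : Finset ι) (ρ : Finset (Finset ι)) : Finset ι := W \ ρ.biUnion id

/-- Λ₁₂ ⊆ Λ₁₀ (cube level). [cite: BalabanImbrieJaffe1988, p.306 (Sect. 5.13)] -/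
theorem lam12_subset (W : Finset ι) (ρ : Finset (Finset ι)) : lam12 W ρ ⊆ W := sdiff_subset

/-- Λ₁₂ contains no large-field cube: the clusters overlapping Λ₁₁ᶜ cover `W ∩ B`. [cite: BalabanImbrieJaffe1988, p.306 (Sect. 5.13)] -/
theorem disjoint_lam12 {W B : Finset ι} {ρ : Finset (Finset ι)} (hρ : ρ ∈ outer W B) : Disjoint (lam12 W ρ) B := by
  rw [disjoint_left]
  intro i hi hiB
  obtain ⟨hiW, hiU⟩ := mem_sdiff.1 hi
  exact hiU ((mem_outer.1 hρ).2.2.2 (mem_inter.2 ⟨hiW, hiB⟩))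

/-- the union of an outer family is disjoint from Λ₁₂. [cite: BalabanImbrieJaffe1988, p.306 (Sect. 5.13)] -/
theorem disjoint_biUnion_lam12 (W : Finset ι) (ρ : Finset (Finset ι)) : Disjoint (ρ.biUnion id) (lam12 W ρ) := disjoint_sdiff

/-! ## §2 The resummation bijection: a filling `{X_α}` of Λ₁₀ = (its clusters overlapping Λ₁₁ᶜ, a filling of Λ₁₂) -/

/-- the clusters of a family that overlap Λ₁₁ᶜ. [cite: BalabanImbrieJaffe1988, (5.14.1) p.308] -/
def outerPart (B : Finset ι) (π : Finset (Finset ι)) : Finset (Finset ι) := π.filter (Overlaps B)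

/-- the clusters of a family that do not overlap Λ₁₁ᶜ (*"clusters not intersecting Λ₁₁^{(k)c}"*, p. 306).
[cite: BalabanImbrieJaffe1988, p.306 (Sect. 5.13)] -/
def innerPart (B : Finset ι) (π : Finset (Finset ι)) : Finset (Finset ι) := π.filter fun X => ¬ Overlaps B X

/-- a family is the disjoint union of its outer and inner parts. [cite: BalabanImbrieJaffe1988, (5.14.1) p.308] -/
theorem outerPart_union_innerPart (B : Finset ι) (π : Finset (Finset ι)) : outerPart B π ∪ innerPart B π = π :=
  filter_union_filter_not_eq _ _

/-- the outer and inner parts are disjoint families. [cite: BalabanImbrieJaffe1988, (5.14.1) p.308] -/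
theorem disjoint_outerPart_innerPart (B : Finset ι) (π : Finset (Finset ι)) : Disjoint (outerPart B π) (innerPart B π) :=
  disjoint_filter_filter_not π π (Overlaps B)

/-- the inner part is the complement of the outer part. [cite: BalabanImbrieJaffe1988, (5.14.1) p.308] -/
theorem innerPart_eq_sdiff (B : Finset ι) (π : Finset (Finset ι)) : innerPart B π = π \ outerPart B π := by
  rw [innerPart, outerPart, filter_not]

/-- **the outer part of a filling of `W` is an outer family** (the clusters of `{X_α}` overlapping Λ₁₁ᶜ are pairwise disjoint and
contain every large-field cube of `W`, since every cube of `W` lies in some cluster). [cite: BalabanImbrieJaffe1988, (5.14.1) p.308] -/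
theorem outerPart_mem_outer {W B : Finset ι} {π : Finset (Finset ι)} (hπ : IsSetPartition W π) : outerPart B π ∈ outer W B := by
  refine mem_outer.2 ⟨fun X hX => hπ.subset (mem_filter.1 hX).1, hπ.of_subset (filter_subset _ _),
    fun X hX => (mem_filter.1 hX).2, fun i hi => ?_⟩
  obtain ⟨hiW, hiB⟩ := mem_inter.1 hi
  obtain ⟨P, hP, hiP⟩ := hπ.exists_mem hiW
  exact mem_biUnion.2 ⟨P, mem_filter.2 ⟨hP, ⟨i, mem_inter.2 ⟨hiP, hiB⟩⟩⟩, hiP⟩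

/-- **the inner part of a filling of `W` is a filling of Λ₁₂** (of the outer part). [cite: BalabanImbrieJaffe1988, p.306 (Sect. 5.13)] -/
theorem innerPart_mem_setPartitions {W B : Finset ι} {π : Finset (Finset ι)} (hπ : IsSetPartition W π) :
    innerPart B π ∈ setPartitions (lam12 W (outerPart B π)) := by
  rw [mem_setPartitions, innerPart_eq_sdiff, lam12]
  exact hπ.sdiff (filter_subset _ _)

/-- **Λ₁₂ as printed** (p. 306: *"the set of sites in clusters not intersecting Λ₁₁^{(k)c}"*): for a filling `π` of `W`, the complement
of the clusters overlapping Λ₁₁ᶜ is the union of the clusters not overlapping Λ₁₁ᶜ. [cite: BalabanImbrieJaffe1988, p.306 (Sect. 5.13)] -/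
theorem lam12_outerPart {W B : Finset ι} {π : Finset (Finset ι)} (hπ : IsSetPartition W π) :
    lam12 W (outerPart B π) = (innerPart B π).biUnion id :=
  (mem_setPartitions.1 (innerPart_mem_setPartitions (B := B) hπ)).biUnion_id.symm

/-- conversely, **an outer family together with a filling of its Λ₁₂ is a filling of `W`**.
[cite: BalabanImbrieJaffe1988, (5.14.1) p.308] -/
theorem union_isSetPartition {W B : Finset ι} {ρ κ : Finset (Finset ι)} (hρ : ρ ∈ outer W B)
    (hκ : IsSetPartition (lam12 W ρ) κ) : IsSetPartition W (ρ ∪ κ) := by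
  have h := (mem_outer.1 hρ).2.1.union hκ (disjoint_biUnion_lam12 W ρ)
  rwa [lam12, union_sdiff_of_subset (biUnion_subset_of_mem_outer hρ)] at h

/-- the two families of the converse construction are disjoint. [cite: BalabanImbrieJaffe1988, (5.14.1) p.308] -/
theorem disjoint_of_outer_of_filling {W B : Finset ι} {ρ κ : Finset (Finset ι)} (hρ : ρ ∈ outer W B)
    (hκ : IsSetPartition (lam12 W ρ) κ) : Disjoint ρ κ :=
  (mem_outer.1 hρ).2.1.disjoint_family hκ (disjoint_biUnion_lam12 W ρ)

/-- a cluster of a filling of Λ₁₂ does not overlap Λ₁₁ᶜ. [cite: BalabanImbrieJaffe1988, p.306 (Sect. 5.13)] -/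
theorem not_overlaps_of_mem_filling {W B : Finset ι} {ρ κ : Finset (Finset ι)} (hρ : ρ ∈ outer W B)
    (hκ : IsSetPartition (lam12 W ρ) κ) {X : Finset ι} (hX : X ∈ κ) : ¬ Overlaps B X :=
  not_overlaps_of_subset (hκ.subset hX) (disjoint_lam12 hρ)

/-- the outer part of the glued filling is the outer family. [cite: BalabanImbrieJaffe1988, (5.14.1) p.308] -/
theorem outerPart_union {W B : Finset ι} {ρ κ : Finset (Finset ι)} (hρ : ρ ∈ outer W B)
    (hκ : IsSetPartition (lam12 W ρ) κ) : outerPart B (ρ ∪ κ) = ρ := by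
  ext X
  simp only [outerPart, mem_filter, mem_union]
  constructor
  · rintro ⟨hX | hX, hov⟩
    · exact hX
    · exact absurd hov (not_overlaps_of_mem_filling hρ hκ hX)
  · intro hX
    exact ⟨Or.inl hX, (mem_outer.1 hρ).2.2.1 X hX⟩

/-- the inner part of the glued filling is the filling of Λ₁₂. [cite: BalabanImbrieJaffe1988, (5.14.1) p.308] -/
theorem innerPart_union {W B : Finset ι} {ρ κ : Finset (Finset ι)} (hρ : ρ ∈ outer W B)
    (hκ : IsSetPartition (lam12 W ρ) κ) : innerPart B (ρ ∪ κ) = κ := by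
  ext X
  simp only [innerPart, mem_filter, mem_union]
  constructor
  · rintro ⟨hX | hX, hov⟩
    · exact absurd ((mem_outer.1 hρ).2.2.1 X hX) hov
    · exact hX
  · intro hX
    exact ⟨Or.inr hX, not_overlaps_of_mem_filling hρ hκ hX⟩

/-- **The resummation in Λ₁₂ as a change of summation index** (p. 308 *"we resum the decoupling and Mayer expansions in Λ₁₂^{(k)}"*):
summing over the fillings `{X_α}` of `W` is summing over the families `{X_α}` overlapping Λ₁₁ᶜ and then over the fillings of the
corresponding Λ₁₂ — the map `π ↦ (clusters of π overlapping Λ₁₁ᶜ, the others)` is a bijection with inverse `(ρ, κ) ↦ ρ ∪ κ`.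
[cite: BalabanImbrieJaffe1988, (5.14.1) p.308] -/
theorem sum_setPartitions_split {M : Type*} [AddCommMonoid M] (W B : Finset ι) (f : Finset (Finset ι) → M) :
    ∑ π ∈ setPartitions W, f π = ∑ ρ ∈ outer W B, ∑ κ ∈ setPartitions (lam12 W ρ), f (ρ ∪ κ) := by
  rw [sum_sigma']
  refine sum_nbij' (fun π => (⟨outerPart B π, innerPart B π⟩ : Σ _ : Finset (Finset ι), Finset (Finset ι)))
    (fun x => x.1 ∪ x.2) ?_ ?_ ?_ ?_ ?_
  · intro π hπ
    rw [mem_setPartitions] at hπ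
    exact mem_sigma.2 ⟨outerPart_mem_outer hπ, innerPart_mem_setPartitions hπ⟩
  · rintro ⟨ρ, κ⟩ hx
    obtain ⟨hρ, hκ⟩ := mem_sigma.1 hx
    exact mem_setPartitions.2 (union_isSetPartition hρ (mem_setPartitions.1 hκ))
  · intro π _
    exact outerPart_union_innerPart B π
  · rintro ⟨ρ, κ⟩ hx
    obtain ⟨hρ, hκ⟩ := mem_sigma.1 hx
    rw [mem_setPartitions] at hκ
    simp only [outerPart_union hρ hκ, innerPart_union hρ hκ]
  · intro π _
    simp only [outerPart_union_innerPart]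

/-- **The resummation for products of activities**: `Σ_{{X_α} filling W} Π_α g(X_α) = Σ_{{X_α} overlapping Λ₁₁ᶜ} Π_α g(X_α) ·
Σ_{{Y_β} filling Λ₁₂} Π_β g(Y_β)` for EVERY activity `g` (the two sub-families are disjoint, so the product splits).
[cite: BalabanImbrieJaffe1988, (5.14.1) p.308] -/
theorem sum_setPartitions_prod_split {R : Type*} [CommSemiring R] (W B : Finset ι) (g : Finset ι → R) :
    ∑ π ∈ setPartitions W, ∏ X ∈ π, g X =
      ∑ ρ ∈ outer W B, (∏ X ∈ ρ, g X) * ∑ κ ∈ setPartitions (lam12 W ρ), ∏ X ∈ κ, g X := by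
  rw [sum_setPartitions_split W B]
  refine sum_congr rfl fun ρ hρ => ?_
  rw [mul_sum]
  refine sum_congr rfl fun κ hκ => ?_
  rw [prod_union (disjoint_of_outer_of_filling hρ (mem_setPartitions.1 hκ))]

/-! ## §3 (5.14.1) from the cluster expansion (5.13.4) in the large-field-free subregions -/

/-- **(5.14.1)** p. 308 [PDF 52], verbatim: *"To extract the perturbative terms, we resum the decoupling and Mayer expansions in
Λ₁₂^{(k)}. … We obtain for the expansion in (5.13.4) Σ_{{X_α}} Π_α g₂(X_α) = Σ_{{X_α} overlapping Λ₁₁^{(k)c}} Π_α g₂(X_α) z_F(Λ₁₂^{(k)}),"*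
— ABSTRACT FORM: if the cluster expansion (5.13.4) holds, with the same activities, in every subregion `W' ⊆ W` free of large-field
cubes (`hce`: the un-expanded quantity `zF W'` equals the sum over the fillings of `W'` — p. 306: the activity of a cluster not
intersecting Λ₁₁^{(k)c} is computed *"by integrating over the fields in X only"*, so it does not depend on the ambient region), then
the full expansion regroups as printed. [cite: BalabanImbrieJaffe1988, (5.14.1) p.308] -/
theorem eq5141_of_clusterExpansion {R : Type*} [CommSemiring R] (W B : Finset ι) (g : Finset ι → R) (zF : Finset ι → R)
    (hce : ∀ W' ⊆ W, Disjoint W' B → ∑ κ ∈ setPartitions W', ∏ X ∈ κ, g X = zF W') :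
    ∑ π ∈ setPartitions W, ∏ X ∈ π, g X = ∑ ρ ∈ outer W B, (∏ X ∈ ρ, g X) * zF (lam12 W ρ) := by
  rw [sum_setPartitions_prod_split W B g]
  exact sum_congr rfl fun ρ hρ => by rw [hce _ (lam12_subset W ρ) (disjoint_lam12 hρ)]


/-! ## §4 *"We resum the decoupling and Mayer expansions in Λ₁₂"*: `z_F(Λ₁₂) = Σ_{fillings of Λ₁₂} Π g₂` -/

section Resummation

variable {R : Type*} [CommRing R]

/-- the Mayer polymers inside a region: p. 299 (5.11.1)/(5.11.2) and p. 308 *"Ṽ^{(k)}(Λ₁₂^{(k)}) = Σ_{Y⊂Λ₁₂^{(k)}} V^{(k)}(Y)"* — the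
members `Y` of the (finite) polymer family `Ys` (sets of cube indices) contained in `W'`. [cite: BalabanImbrieJaffe1988, (5.14.1) p.308] -/
def polysIn (Ys : Finset (Finset ι)) (W' : Finset ι) : Finset (Finset ι) := Ys.filter (· ⊆ W')

/-- membership in `polysIn`. [cite: BalabanImbrieJaffe1988, (5.14.1) p.308] -/
theorem mem_polysIn {Ys : Finset (Finset ι)} {W' Y : Finset ι} : Y ∈ polysIn Ys W' ↔ Y ∈ Ys ∧ Y ⊆ W' := mem_filter

/-- p. 308: *"Note that W₅^{(k)}(X) ≠ 0 only for X at the boundary of Λ₁₀^{(k)}. Thus W₅^{(k)}-terms will not appear in the resummed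
expansion."* — polymers overlapping Λ₁₁ᶜ (the boundary collar Λ₁₀∖Λ₁₁ lies in Λ₁₁ᶜ) do not lie inside a large-field-free region, so
adjoining them (`X5`) to the Mayer family changes nothing inside such a region. [cite: BalabanImbrieJaffe1988, (5.14.1) p.308] -/
theorem polysIn_union_of_overlaps {Ys X5 : Finset (Finset ι)} {B W' : Finset ι} (h5 : ∀ X ∈ X5, Overlaps B X)
    (hW' : Disjoint W' B) : polysIn (Ys ∪ X5) W' = polysIn Ys W' := by
  ext Y
  simp only [polysIn, mem_filter, mem_union]
  constructor
  · rintro ⟨hY | hY, hsub⟩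
    · exact ⟨hY, hsub⟩
    · exact absurd (h5 Y hY) (not_overlaps_of_subset hsub hW')
  · rintro ⟨hY, hsub⟩
    exact ⟨Or.inl hY, hsub⟩

/-- p. 306 [PDF 50], *"S_Y, S₅ compatible with X_α (each Y, X is contained in X_α or the corresponding component of Λ₁₁^{(k)c})"* — inside
Λ₁₂ (no component of Λ₁₁ᶜ available): every Mayer polymer of `S` lies inside a cluster of the family `κ`.
[cite: BalabanImbrieJaffe1988, p.306 (Sect. 5.13)] -/
def Compat (κ S : Finset (Finset ι)) : Prop := ∀ Y ∈ S, ∃ X ∈ κ, Y ⊆ X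

/-- decidability of compatibility. [cite: BalabanImbrieJaffe1988, p.306 (Sect. 5.13)] -/
instance instDecidableCompat (κ S : Finset (Finset ι)) : Decidable (Compat κ S) :=
  inferInstanceAs (Decidable (∀ Y ∈ S, ∃ X ∈ κ, Y ⊆ X))

/-- the Mayer polymers of `S` inside the cluster `X` (the data the activity `g₁(X)` of a cluster depends on: p. 306 *"⟨·⟩_{s_Γ,X} is
defined by integrating over the fields in X only"*). [cite: BalabanImbrieJaffe1988, p.306 (Sect. 5.13)] -/
def restrictTo (S : Finset (Finset ι)) (X : Finset ι) : Finset (Finset ι) := S.filter (· ⊆ X)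

/-- membership in `restrictTo`. [cite: BalabanImbrieJaffe1988, p.306 (Sect. 5.13)] -/
theorem mem_restrictTo {S : Finset (Finset ι)} {X Y : Finset ι} : Y ∈ restrictTo S X ↔ Y ∈ S ∧ Y ⊆ X := mem_filter

/-- p. 306 [PDF 50], last display, verbatim: *"g₂(X_α) = Σ_{S_Y,S₅ compatible with X_α} g₁(X_α)."* — for a cluster inside Λ₁₂: the sum
of the fixed-Mayer-set activities `g₁(X; T)` over the Mayer sets `T` inside `X`. [cite: BalabanImbrieJaffe1988, p.306 (Sect. 5.13)] -/
def g2 (Ys : Finset (Finset ι)) (g₁ : Finset ι → Finset (Finset ι) → R) (X : Finset ι) : R :=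
  ∑ T ∈ (polysIn Ys X).powerset, g₁ X T

omit [DecidableEq ι] in
/-- only the empty Mayer set is compatible with the empty family. [cite: BalabanImbrieJaffe1988, p.306 (Sect. 5.13)] -/
theorem compat_empty_iff {S : Finset (Finset ι)} : Compat ∅ S ↔ S = ∅ := by
  constructor
  · intro h
    rw [eq_empty_iff_forall_notMem]
    intro Y hY
    obtain ⟨X, hX, -⟩ := h Y hY
    exact notMem_empty X hX
  · rintro rfl Y hY
    exact absurd hY (notMem_empty Y)

omit [DecidableEq ι] in
/-- a nonempty set inside one of two disjoint sets is not inside the other. [cite: BalabanImbrieJaffe1988, p.306 (Sect. 5.13)] -/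
theorem not_subset_of_subset_of_disjoint {Y X X' : Finset ι} (hY : Y.Nonempty) (hYX' : Y ⊆ X') (hd : Disjoint X X') :
    ¬ Y ⊆ X := by
  intro hYX
  obtain ⟨i, hi⟩ := hY
  exact disjoint_left.1 hd (hYX hi) (hYX' hi)

/-- **Exchange of the Mayer sum with the product over clusters** (the algebra behind *"g₂(X_α) = Σ_{S_Y,S₅ compatible with X_α} g₁(X_α)"*
inside Λ₁₂): for a family `κ` of pairwise disjoint clusters, summing `Π_{X∈κ} g₁(X; S∩𝒫(X))` over the Mayer sets `S` compatible with
`κ` gives `Π_{X∈κ} g₂(X)` — a compatible `S` is the disjoint union of its parts inside the clusters, and these parts are arbitrary.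
[cite: BalabanImbrieJaffe1988, p.306 (Sect. 5.13)] -/
theorem sum_compat_prod_eq_prod_g2 (Ys : Finset (Finset ι)) (hYs : ∀ Y ∈ Ys, Y.Nonempty)
    (g₁ : Finset ι → Finset (Finset ι) → R) (κ : Finset (Finset ι)) (hκ : (κ : Set (Finset ι)).PairwiseDisjoint id) :
    ∑ S ∈ Ys.powerset.filter (Compat κ), ∏ X ∈ κ, g₁ X (restrictTo S X) = ∏ X ∈ κ, g2 Ys g₁ X := by
  induction κ using Finset.induction_on with
  | empty =>
    have hf : Ys.powerset.filter (Compat ∅) = {∅} := by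
      ext S
      simp only [mem_filter, mem_powerset, compat_empty_iff, mem_singleton]
      exact ⟨fun h => h.2, fun h => ⟨h ▸ empty_subset _, h⟩⟩
    rw [hf, sum_singleton, prod_empty, prod_empty]
  | insert X κ' hX ih =>
    have hκ' : (κ' : Set (Finset ι)).PairwiseDisjoint id := hκ.subset (coe_subset.2 (subset_insert _ _))
    have hXd : ∀ X' ∈ κ', Disjoint X X' := fun X' hX' =>
      hκ (mem_coe.2 (mem_insert_self X κ')) (mem_coe.2 (mem_insert_of_mem hX')) (fun h => hX (h ▸ hX'))
    -- a Mayer polymer inside a cluster of `κ'` is not inside `X`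
    have hnot : ∀ S ⊆ Ys, ∀ Y ∈ S, ∀ X' ∈ κ', Y ⊆ X' → ¬ Y ⊆ X := fun S hS Y hY X' hX' hYX' =>
      not_subset_of_subset_of_disjoint (hYs Y (hS hY)) hYX' (hXd X' hX')
    rw [prod_insert hX, ← ih hκ', g2, sum_mul_sum, ← sum_product']
    simp_rw [prod_insert hX]
    refine sum_nbij' (fun S => (restrictTo S X, S.filter fun Y => ¬ Y ⊆ X)) (fun x => x.1 ∪ x.2) ?_ ?_ ?_ ?_ ?_
    · intro S hS
      obtain ⟨hSY, hcomp⟩ := mem_filter.1 hS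
      rw [mem_powerset] at hSY
      refine mem_product.2 ⟨mem_powerset.2 fun Y hY => ?_, mem_filter.2 ⟨mem_powerset.2 fun Y hY => hSY (mem_filter.1 hY).1, ?_⟩⟩
      · obtain ⟨hYS, hYX⟩ := mem_restrictTo.1 hY
        exact mem_polysIn.2 ⟨hSY hYS, hYX⟩
      · intro Y hY
        obtain ⟨hYS, hYX⟩ := mem_filter.1 hY
        obtain ⟨X'', hX'', hYX''⟩ := hcomp Y hYS
        rcases mem_insert.1 hX'' with rfl | hX''
        · exact absurd hYX'' hYX
        · exact ⟨X'', hX'', hYX''⟩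
    · rintro ⟨T, S'⟩ hx
      obtain ⟨hT, hS'⟩ := mem_product.1 hx
      rw [mem_powerset] at hT
      obtain ⟨hS'Y, hcomp'⟩ := mem_filter.1 hS'
      rw [mem_powerset] at hS'Y
      refine mem_filter.2 ⟨mem_powerset.2 (union_subset (fun Y hY => (mem_polysIn.1 (hT hY)).1) hS'Y), fun Y hY => ?_⟩
      rcases mem_union.1 hY with hY | hY
      · exact ⟨X, mem_insert_self X κ', (mem_polysIn.1 (hT hY)).2⟩
      · obtain ⟨X', hX', hYX'⟩ := hcomp' Y hY
        exact ⟨X', mem_insert_of_mem hX', hYX'⟩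
    · intro S _
      exact filter_union_filter_not_eq _ S
    · rintro ⟨T, S'⟩ hx
      obtain ⟨hT, hS'⟩ := mem_product.1 hx
      rw [mem_powerset] at hT
      obtain ⟨hS'Y, hcomp'⟩ := mem_filter.1 hS'
      rw [mem_powerset] at hS'Y
      have hT' : ∀ Y ∈ T, Y ⊆ X := fun Y hY => (mem_polysIn.1 (hT hY)).2
      have hS'' : ∀ Y ∈ S', ¬ Y ⊆ X := fun Y hY => by
        obtain ⟨X', hX', hYX'⟩ := hcomp' Y hY
        exact hnot S' hS'Y Y hY X' hX' hYX'
      refine Prod.ext ?_ ?_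
      · ext Y
        simp only [restrictTo, mem_filter, mem_union]
        exact ⟨fun ⟨h, hYX⟩ => h.elim id fun hY => absurd hYX (hS'' Y hY), fun hY => ⟨Or.inl hY, hT' Y hY⟩⟩
      · ext Y
        simp only [mem_filter, mem_union]
        exact ⟨fun ⟨h, hYX⟩ => h.elim (fun hY => absurd (hT' Y hY) hYX) id, fun hY => ⟨Or.inr hY, hS'' Y hY⟩⟩
    · intro S hS
      obtain ⟨hSY, -⟩ := mem_filter.1 hS
      rw [mem_powerset] at hSY
      refine congrArg (g₁ X (restrictTo S X) * ·) (prod_congr rfl fun X' hX' => ?_)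
      congr 1
      ext Y
      simp only [restrictTo, mem_filter]
      exact ⟨fun ⟨hYS, hYX'⟩ => ⟨⟨hYS, hnot S hSY Y hYS X' hX' hYX'⟩, hYX'⟩, fun ⟨⟨hYS, _⟩, hYX'⟩ => ⟨hYS, hYX'⟩⟩

/-- on a family of clusters inside `W'`, compatibility forces the Mayer set inside `W'`. [cite: BalabanImbrieJaffe1988, p.306 (Sect. 5.13)] -/
theorem filter_compat_polysIn {Ys κ : Finset (Finset ι)} {W' : Finset ι} (hκ : ∀ X ∈ κ, X ⊆ W') :
    (polysIn Ys W').powerset.filter (Compat κ) = Ys.powerset.filter (Compat κ) := by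
  ext S
  simp only [mem_filter, mem_powerset]
  constructor
  · rintro ⟨hS, hc⟩
    exact ⟨fun Y hY => (mem_polysIn.1 (hS hY)).1, hc⟩
  · rintro ⟨hS, hc⟩
    refine ⟨fun Y hY => ?_, hc⟩
    obtain ⟨X, hX, hYX⟩ := hc Y hY
    exact mem_polysIn.2 ⟨hS hY, hYX.trans (hκ X hX)⟩

variable {Φ : Type*}

/-- the Boltzmann factor of a region, p. 308 *"e^{−Ṽ^{(k)}(Λ₁₂^{(k)})}"* with *"Ṽ^{(k)}(Λ₁₂^{(k)}) = Σ_{Y⊂Λ₁₂^{(k)}} V^{(k)}(Y)"*: the product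
over the Mayer polymers inside `W'` of the one-polymer factors `b_Y = e^{−V^{(k)}(Y)}` (`boltz_exp`), as a function of the fields `φ`.
[cite: BalabanImbrieJaffe1988, (5.14.1) p.308] -/
def boltz (Ys : Finset (Finset ι)) (b : Finset ι → Φ → R) (W' : Finset ι) : Φ → R := fun φ => ∏ Y ∈ polysIn Ys W', b Y φ

/-- the Mayer factors of a Mayer set, p. 299 (5.11.2) shape *"Π (e^{−W} − 1)"*: `Π_{Y∈S} (b_Y − 1)`.
[cite: BalabanImbrieJaffe1988, (5.11.2) p.299] -/
def mayer (b : Finset ι → Φ → R) (S : Finset (Finset ι)) : Φ → R := fun φ => ∏ Y ∈ S, (b Y φ - 1)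

/-- **the Mayer expansion of the Boltzmann factor of a region** ((5.11.2)/(5.15.1) shape, read for the V^{(k)}(Y) inside Λ₁₂):
`e^{−Ṽ(W')} = Σ_{S ⊆ 𝒫(W')} Π_{Y∈S}(e^{−V(Y)} − 1)`. [cite: BalabanImbrieJaffe1988, (5.11.2) p.299] -/
theorem boltz_eq_sum_mayer (Ys : Finset (Finset ι)) (b : Finset ι → Φ → R) (W' : Finset ι) :
    boltz Ys b W' = ∑ S ∈ (polysIn Ys W').powerset, mayer b S := by
  funext φ
  rw [Finset.sum_apply]
  simp only [boltz, mayer]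
  rw [← prod_one_add]
  exact prod_congr rfl fun Y _ => by ring

/-- **z_F of a region**, p. 308 [PDF 52] verbatim: *"z_F(Λ₁₂^{(k)}) = ⟨χ′_{Λ₁₂^{(k)}} Π_{σ₁: X_{σ₁}⊂Λ₁₂^{(k)}} F^{m̄}_{k,loc}(X_{σ₁})
e^{−Ṽ^{(k)}(Λ₁₂^{(k)})}⟩_{1,Λ₁₂^{(k)}}"* — with `E W'` the (linear) expectation ⟨·⟩_{1,W'} in the fields of `W'`, `G W'` the observable
`χ′_{W'} Π_{σ₁: X_{σ₁}⊂W'} F^{m̄}_{k,loc}(X_{σ₁})` and `boltz Ys b W'` the factor `e^{−Ṽ(W')}`. [cite: BalabanImbrieJaffe1988, (5.14.1) p.308] -/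
def zF (E : Finset ι → (Φ → R) →ₗ[R] R) (G : Finset ι → Φ → R) (Ys : Finset (Finset ι)) (b : Finset ι → Φ → R)
    (W' : Finset ι) : R :=
  E W' (G W' * boltz Ys b W')

/-- the Mayer-expanded pieces of `z_F(W')`: the expectation `⟨G_{W'} Π_{Y∈S}(e^{−V(Y)} − 1)⟩_{1,W'}` with a fixed Mayer set `S` — the
quantities that the decoupling expansion of Sect. 5.13 expands into clusters. [cite: BalabanImbrieJaffe1988, (5.14.1) p.308] -/
def zS (E : Finset ι → (Φ → R) →ₗ[R] R) (G : Finset ι → Φ → R) (b : Finset ι → Φ → R) (W' : Finset ι)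
    (S : Finset (Finset ι)) : R :=
  E W' (G W' * mayer b S)

/-- **the Mayer expansion of z_F** (linearity of the expectation): `z_F(W') = Σ_{S ⊆ 𝒫(W')} ⟨G_{W'} Π_{Y∈S}(e^{−V(Y)} − 1)⟩_{1,W'}`.
[cite: BalabanImbrieJaffe1988, (5.14.1) p.308] -/
theorem zF_eq_sum_zS (E : Finset ι → (Φ → R) →ₗ[R] R) (G : Finset ι → Φ → R) (Ys : Finset (Finset ι))
    (b : Finset ι → Φ → R) (W' : Finset ι) : zF E G Ys b W' = ∑ S ∈ (polysIn Ys W').powerset, zS E G b W' S := by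
  simp only [zF, zS, boltz_eq_sum_mayer, mul_sum, map_sum]

/-- **The exchange behind the right-hand equality of (5.13.4)** (p. 306 [PDF 50]: *"Σ_{S_Y}Σ_{S₅} … Σ_{{X_α} filling Λ₁₀^{(k)}} Π_α g₁(X_α)
= … Σ_{{X_α}} Π_α g₂(X_α). (5.13.4) Here g₂(X_α) is obtained by summing over S_Y, S₅ compatible with X_α"*), in a region where
compatibility is containment in a cluster (inside Λ₁₂): summing the fixed-Mayer-set cluster products over the Mayer sets `S` and the
compatible fillings is summing `Π g₂` over the fillings. (The expansion (5.13.3) itself is not reproduced here; only this exchange of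
summations.) [cite: BalabanImbrieJaffe1988, (5.13.4) p.306] -/
theorem eq5134_exchange (Ys : Finset (Finset ι)) (hYs : ∀ Y ∈ Ys, Y.Nonempty) (g₁ : Finset ι → Finset (Finset ι) → R)
    (W' : Finset ι) :
    ∑ S ∈ (polysIn Ys W').powerset, ∑ κ ∈ setPartitions W',
        (if Compat κ S then ∏ X ∈ κ, g₁ X (restrictTo S X) else 0) = ∑ κ ∈ setPartitions W', ∏ X ∈ κ, g2 Ys g₁ X := by
  rw [sum_comm]
  refine sum_congr rfl fun κ hκ => ?_
  have hκ' := mem_setPartitions.1 hκ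
  rw [← sum_filter, filter_compat_polysIn fun X hX => hκ'.subset hX,
    sum_compat_prod_eq_prod_g2 Ys hYs g₁ κ hκ'.pairwiseDisjoint]

/-- **Resummation of the Mayer and decoupling expansions in a large-field-free region** (p. 308 *"we resum the decoupling and Mayer
expansions in Λ₁₂^{(k)}"*, read backwards): if for every Mayer set `S` inside `W'` the fixed-`S` decoupling expansion of Sect. 5.13
holds in `W'` — (5.13.3) with the factorization of p. 306: `⟨G_{W'} Π_{Y∈S}(e^{−V(Y)} − 1)⟩_{1,W'} = Σ_{{X_α} filling W', S compatible}
Π_α g₁(X_α; S ∩ 𝒫(X_α))`, the activity of a cluster depending on `S` only through the Mayer polymers inside it (*"integrating over the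
fields in X only"*) — then `z_F(W') = Σ_{{X_α} filling W'} Π_α g₂(X_α)` with `g₂ = Σ_{S compatible} g₁` (p. 306, last display).
[cite: BalabanImbrieJaffe1988, (5.14.1) p.308] -/
theorem zF_eq_sum_fillings {E : Finset ι → (Φ → R) →ₗ[R] R} {G : Finset ι → Φ → R} {Ys : Finset (Finset ι)}
    {b : Finset ι → Φ → R} {g₁ : Finset ι → Finset (Finset ι) → R} {W' : Finset ι} (hYs : ∀ Y ∈ Ys, Y.Nonempty)
    (hdec : ∀ S ⊆ polysIn Ys W',
      zS E G b W' S = ∑ κ ∈ setPartitions W', if Compat κ S then ∏ X ∈ κ, g₁ X (restrictTo S X) else 0) :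
    zF E G Ys b W' = ∑ κ ∈ setPartitions W', ∏ X ∈ κ, g2 Ys g₁ X := by
  rw [zF_eq_sum_zS, ← eq5134_exchange Ys hYs g₁ W']
  exact sum_congr rfl fun S hS => hdec S (mem_powerset.1 hS)

end Resummation

/-! ## §5 (5.14.1) assembled, and its two companions on p. 308 -/

section Assembly

variable {R : Type*} [CommRing R] {Φ : Type*}

/-- **(5.14.1)** p. 308 [PDF 52], verbatim: *"To extract the perturbative terms, we resum the decoupling and Mayer expansions in Λ₁₂^{(k)}.
Note that W₅^{(k)}(X) ≠ 0 only for X at the boundary of Λ₁₀^{(k)}. Thus W₅^{(k)}-terms will not appear in the resummed expansion. We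
obtain for the expansion in (5.13.4) Σ_{{X_α}} Π_α g₂(X_α) = Σ_{{X_α} overlapping Λ₁₁^{(k)c}} Π_α g₂(X_α) z_F(Λ₁₂^{(k)}), where
z_F(Λ₁₂^{(k)}) = ⟨χ′_{Λ₁₂^{(k)}} Π_{σ₁: X_{σ₁}⊂Λ₁₂^{(k)}} F^{m̄}_{k,loc}(X_{σ₁}) e^{−Ṽ^{(k)}(Λ₁₂^{(k)})}⟩_{1,Λ₁₂^{(k)}}, Ṽ^{(k)}(Λ₁₂^{(k)}) =
Σ_{Y⊂Λ₁₂^{(k)}} V^{(k)}(Y). (5.14.1)"* — DERIVED over the cube-index polymer model: `W` = the cubes of Λ₁₀^{(k)}, `B` = those meeting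
Λ₁₁^{(k)c}, fillings `{X_α}` = set partitions of `W`, `g` = the activities `g₂` of (5.13.4), which on the clusters not intersecting
Λ₁₁^{(k)c} are the Mayer sums `Σ_{S compatible} g₁` (`hg`, p. 306 last display); `hdec` = the fixed-Mayer-set decoupling expansion
(5.13.3) + p. 306 factorization in every large-field-free subregion, with the same `g₁` (*"⟨·⟩_{s_Γ,X} is defined by integrating over the
fields in X only"*); `Λ₁₂ = lam12 W {X_α}`. [cite: BalabanImbrieJaffe1988, (5.14.1) p.308] -/
theorem eq5141 (W B : Finset ι) (g : Finset ι → R) (E : Finset ι → (Φ → R) →ₗ[R] R) (G : Finset ι → Φ → R)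
    (Ys : Finset (Finset ι)) (b : Finset ι → Φ → R) (g₁ : Finset ι → Finset (Finset ι) → R)
    (hYs : ∀ Y ∈ Ys, Y.Nonempty) (hg : ∀ X ⊆ W, X.Nonempty → Disjoint X B → g X = g2 Ys g₁ X)
    (hdec : ∀ W' ⊆ W, Disjoint W' B → ∀ S ⊆ polysIn Ys W',
      zS E G b W' S = ∑ κ ∈ setPartitions W', if Compat κ S then ∏ X ∈ κ, g₁ X (restrictTo S X) else 0) :
    ∑ π ∈ setPartitions W, ∏ X ∈ π, g X = ∑ ρ ∈ outer W B, (∏ X ∈ ρ, g X) * zF E G Ys b (lam12 W ρ) := by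
  refine eq5141_of_clusterExpansion W B g _ fun W' hW' hdis => ?_
  rw [zF_eq_sum_fillings hYs (hdec W' hW' hdis)]
  refine sum_congr rfl fun κ hκ => prod_congr rfl fun X hX => ?_
  have hκ' := mem_setPartitions.1 hκ
  exact hg X ((hκ'.subset hX).trans hW') (hκ'.nonempty_of_mem hX) (hdis.mono_left (hκ'.subset hX))

/-- the interaction of a region, p. 308 verbatim: *"Ṽ^{(k)}(Λ₁₂^{(k)}) = Σ_{Y⊂Λ₁₂^{(k)}} V^{(k)}(Y)"* (as a function of the fields).
[cite: BalabanImbrieJaffe1988, (5.14.1) p.308] -/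
def Vtilde (Ys : Finset (Finset ι)) (V : Finset ι → Φ → ℝ) (W' : Finset ι) : Φ → ℝ := fun φ => ∑ Y ∈ polysIn Ys W', V Y φ

/-- with `b_Y = e^{−V^{(k)}(Y)}` the Boltzmann factor of a region is `e^{−Ṽ^{(k)}(W')}` as printed. [cite: BalabanImbrieJaffe1988, (5.14.1) p.308] -/
theorem boltz_exp (Ys : Finset (Finset ι)) (V : Finset ι → Φ → ℝ) (W' : Finset ι) :
    boltz Ys (fun Y φ => Real.exp (-V Y φ)) W' = fun φ => Real.exp (-Vtilde Ys V W' φ) := by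
  funext φ
  simp only [boltz, Vtilde]
  rw [← sum_neg_distrib, Real.exp_sum]

/-- p. 308, the display after (5.14.1), verbatim: *"We treat z_F(Λ₁₂^{(k)}) as follows: z_F(Λ₁₂^{(k)}) = (z_F(Λ₁₂^{(k)})/z(Λ₁₂^{(k)}))
exp(log z(Λ₁₂^{(k)})), where z(Λ₁₂^{(k)}) = z_{F=1}(Λ₁₂^{(k)})"* — for a positive normalization `z`. [cite: BalabanImbrieJaffe1988, (5.14.2) p.308] -/
theorem zF_eq_ratio_mul_exp_log (zF' : ℝ) {z : ℝ} (hz : 0 < z) : zF' = zF' / z * Real.exp (Real.log z) := by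
  rw [Real.exp_log hz, div_mul_cancel₀ zF' hz.ne']

/-- `z = z_{F=1}`: the normalization of p. 308 is the `z_F` of the observable `χ′_{W'}` alone (the model's `G` with the `F`-factors
replaced by `1`), i.e. the same functional — recorded as the specialization of `zF` to a second observable family `G₁`.
[cite: BalabanImbrieJaffe1988, (5.14.2) p.308] -/
theorem eq5141_normalization (W B : Finset ι) (g : Finset ι → R) (E : Finset ι → (Φ → R) →ₗ[R] R) (G₁ : Finset ι → Φ → R)
    (Ys : Finset (Finset ι)) (b : Finset ι → Φ → R) (g₁ : Finset ι → Finset (Finset ι) → R)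
    (hYs : ∀ Y ∈ Ys, Y.Nonempty) (hg : ∀ X ⊆ W, X.Nonempty → Disjoint X B → g X = g2 Ys g₁ X)
    (hdec : ∀ W' ⊆ W, Disjoint W' B → ∀ S ⊆ polysIn Ys W',
      zS E G₁ b W' S = ∑ κ ∈ setPartitions W', if Compat κ S then ∏ X ∈ κ, g₁ X (restrictTo S X) else 0) :
    ∑ π ∈ setPartitions W, ∏ X ∈ π, g X = ∑ ρ ∈ outer W B, (∏ X ∈ ρ, g X) * zF E G₁ Ys b (lam12 W ρ) :=
  eq5141 W B g E G₁ Ys b g₁ hYs hg hdec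

end Assembly

end Literature.MathematicalPhysics.QuantumFieldTheory.BalabanImbrieJaffe1984to88.BIJ88Resummation5141
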